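import Literature.Barriers.QuantumAdvantage.TQBFSavitch
import HarnessLib

/-!
# The Tseitin transformation for prenex QBFs: an arbitrary matrix becomes a 3-CNF with
# existentially quantified auxiliary variables (towards TV07 Lemma 4.1 (ii))

Literature / complexity — toolkit for the `PSPACE`-hardness of Trevisan–Vadhan's universal
arithmetized QBF (`QBFUniversal.lean`: its instances are prenex formulas with CNF matrices, while the
tree's `TQBF` (`AaronsonChenOracle.lean`, `PSPACE`-complete by `TQBFFlatStepCode.lean`) has arbitrary
propositional matrices `PropForm ℕ`). The classical remedy (Tseitin 1968; Trevisan–Vadhan §4: "we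
may assume `φ` is in the form `∃x₁∀x₂⋯ψ` where `ψ` is a CNF formula … these restrictions still
preserve the fact that QBF is a `PSPACE`-complete problem") gives every node of the matrix an
auxiliary variable constrained by `≤ 3` clauses of width `≤ 3` to equal the value of its subformula,
and quantifies the auxiliary variables existentially INNERMOST:

* `Tseitin.gates φ a` — the clause list of the matrix `φ` with auxiliary variables `a, a+1, …`
  (post-order; the root gets the LAST one, `a + size φ − 1`), `Tseitin.root`, `length_gates_le`
  (`≤ 3 · size`), `gates_vars_lt` (all variables `< a + size φ` when the matrix's are `< a`);
* `Tseitin.gateVal φ a σ` — the intended values of the auxiliary variables; **`eval_gates_gateVal`**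
  (they satisfy the gate clauses and give the root the value `φ.eval σ`) and **`root_eq_of_eval_gates`**
  (ANY assignment satisfying the gate clauses gives the root the value of `φ` — gate by gate);
* **`Tseitin.eval_iff_exists`** — `φ.eval σ = true ↔ ∃` values of the auxiliary block making
  `gates ++ [[root]]` true (`writeVec` form);
* **`Tseitin.isTrue_tseitinQBF_iff`** (`Tseitin.tseitinQBF`, `Tseitin.cnf`) — for a closed prenex QBF `⟨qs, φ⟩` (variables `< |qs|`), truth is
  preserved by passing to `⟨qs ++ ∃^{size φ}, ofCNF (gates φ |qs| ++ [[root]])⟩` (`qbfEval_congr_matrix`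
  + the `∃`-block lemma `qbfEval_replicate_false_append` of `TQBFSavitch.lean`), which is closed
  (`isClosed_tseitinQBF`) and has a 3-CNF matrix with `≤ 3 size φ + 1` clauses over `|qs| + size φ`
  variables.

Everything is proved; the definitions are plain (no named facts).

## References

* G. S. Tseitin, *On the complexity of derivation in propositional calculus*, in: Studies in
  Constructive Mathematics and Mathematical Logic II (1968) 115–125 (the transformation; cited through
  Arora–Barak).
* [AroraBarakCC2009] S. Arora, B. Barak, CUP 2009, proof of Lemma 6.11 / Claim 2.13-style clause
  encodings of gates (`CKT-SAT ≤ₚ 3SAT`: "for every gate … clauses that are satisfied iff the output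
  wire has the right value"), Thm. 4.13 (`TQBF`).
* [TrevisanVadhan2007] L. Trevisan, S. Vadhan, Comput. Complexity 16 (2007), §4, proof of Lemma 4.1
  ("Without loss of generality, we may assume `φ` is in the form … where `ψ` is a CNF formula").
-/

namespace Literature.Computability.Complexity

namespace Tseitin

open Literature.Barriers.QuantumAdvantage Literature.Barriers.QuantumAdvantage.TQBFRed

/-! ### The gate clauses -/

/-- **The Tseitin clauses of a matrix** with auxiliary variables allocated from `a` in post-order:
returns the clause list and the next free variable; the auxiliary variable of the whole formula is
the last one allocated. Gate encodings: `g ↔ x`: `(¬g ∨ x)(g ∨ ¬x)`; `g ↔ b`: `(g)` or `(¬g)`;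
`g ↔ ¬c`: `(¬g ∨ ¬c)(g ∨ c)`; `g ↔ c₁ ∧ c₂`: `(¬g ∨ c₁)(¬g ∨ c₂)(g ∨ ¬c₁ ∨ ¬c₂)`;
`g ↔ c₁ ∨ c₂`: `(¬g ∨ c₁ ∨ c₂)(g ∨ ¬c₁)(g ∨ ¬c₂)`. [cite: AroraBarakCC2009, Lemma 6.11 (proof)] -/
def gatesAux : PropForm ℕ → ℕ → CNF ℕ × ℕ
  | .var x, a => ([[(a, false), (x, true)], [(a, true), (x, false)]], a + 1)
  | .const b, a => ([[(a, b)]], a + 1)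
  | .neg φ, a =>
    let r := gatesAux φ a
    (r.1 ++ [[(r.2, false), (r.2 - 1, false)], [(r.2, true), (r.2 - 1, true)]], r.2 + 1)
  | .conj φ ψ, a =>
    let r₁ := gatesAux φ a
    let r₂ := gatesAux ψ r₁.2
    (r₁.1 ++ r₂.1 ++ [[(r₂.2, false), (r₁.2 - 1, true)], [(r₂.2, false), (r₂.2 - 1, true)],
      [(r₂.2, true), (r₁.2 - 1, false), (r₂.2 - 1, false)]], r₂.2 + 1)
  | .disj φ ψ, a =>
    let r₁ := gatesAux φ a
    let r₂ := gatesAux ψ r₁.2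
    (r₁.1 ++ r₂.1 ++ [[(r₂.2, false), (r₁.2 - 1, true), (r₂.2 - 1, true)], [(r₂.2, true), (r₁.2 - 1, false)],
      [(r₂.2, true), (r₂.2 - 1, false)]], r₂.2 + 1)

/-- The gate clauses. [cite: AroraBarakCC2009, Lemma 6.11 (proof)] -/
def gates (φ : PropForm ℕ) (a : ℕ) : CNF ℕ := (gatesAux φ a).1

/-- The next free variable after allocating the auxiliaries of `φ` from `a`: `a + size φ`. [folklore] -/
theorem gatesAux_snd (φ : PropForm ℕ) : ∀ a : ℕ, (gatesAux φ a).2 = a + φ.size := by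
  induction φ with
  | var x => intro a; rfl
  | const b => intro a; rfl
  | neg φ ih => intro a; simp only [gatesAux, ih, PropForm.size]; omega
  | conj φ ψ ih₁ ih₂ => intro a; simp only [gatesAux, ih₁, ih₂, PropForm.size]; omega
  | disj φ ψ ih₁ ih₂ => intro a; simp only [gatesAux, ih₁, ih₂, PropForm.size]; omega

/-- **The root auxiliary variable** of `φ` allocated from `a`: `a + size φ − 1`. [folklore] -/
def root (φ : PropForm ℕ) (a : ℕ) : ℕ := a + φ.size - 1

/-- The number of gate clauses is at most `3 · size`. [folklore] -/
theorem length_gates_le (φ : PropForm ℕ) : ∀ a : ℕ, (gates φ a).length ≤ 3 * φ.size := by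
  induction φ with
  | var x => intro a; simp [gates, gatesAux, PropForm.size]
  | const b => intro a; simp [gates, gatesAux, PropForm.size]
  | neg φ ih => intro a; have := ih a; simp only [gates, gatesAux, List.length_append, PropForm.size] at this ⊢; simp; omega
  | conj φ ψ ih₁ ih₂ =>
    intro a; have h₁ := ih₁ a; have h₂ := ih₂ (gatesAux φ a).2
    simp only [gates, gatesAux, List.length_append, PropForm.size] at h₁ h₂ ⊢; simp; omega
  | disj φ ψ ih₁ ih₂ =>
    intro a; have h₁ := ih₁ a; have h₂ := ih₂ (gatesAux φ a).2
    simp only [gates, gatesAux, List.length_append, PropForm.size] at h₁ h₂ ⊢; simp; omega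

/-- Every gate clause has width `≤ 3`. [folklore] -/
theorem isWidthLE_gates (φ : PropForm ℕ) : ∀ a : ℕ, CNF.IsWidthLE 3 (gates φ a) := by
  induction φ with
  | var x => intro a c hc; simp [gates, gatesAux] at hc; rcases hc with rfl | rfl <;> simp
  | const b => intro a c hc; simp [gates, gatesAux] at hc; subst hc; simp
  | neg φ ih =>
    intro a c hc
    simp only [gates, gatesAux, List.mem_append, List.mem_cons, List.not_mem_nil, or_false] at hc
    rcases hc with hc | rfl | rfl
    · exact ih a c hc
    all_goals simp
  | conj φ ψ ih₁ ih₂ =>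
    intro a c hc
    simp only [gates, gatesAux, List.mem_append, List.mem_cons, List.not_mem_nil, or_false] at hc
    rcases hc with (hc | hc) | rfl | rfl | rfl
    · exact ih₁ a c hc
    · exact ih₂ _ c hc
    all_goals simp
  | disj φ ψ ih₁ ih₂ =>
    intro a c hc
    simp only [gates, gatesAux, List.mem_append, List.mem_cons, List.not_mem_nil, or_false] at hc
    rcases hc with (hc | hc) | rfl | rfl | rfl
    · exact ih₁ a c hc
    · exact ih₂ _ c hc
    all_goals simp

/-- **Variable bound**: if the matrix's variables are `< a` then every variable of the gate clauses is
`< a + size φ`. [folklore] -/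
theorem gates_vars_lt (φ : PropForm ℕ) : ∀ a : ℕ, propFormVarBound φ ≤ a →
    ∀ c ∈ gates φ a, ∀ l ∈ c, l.1 < a + φ.size := by
  induction φ with
  | var x =>
    intro a ha c hc l hl
    simp only [propFormVarBound] at ha
    simp [gates, gatesAux] at hc
    rcases hc with rfl | rfl <;> simp at hl <;> rcases hl with rfl | rfl <;> simp only [PropForm.size] <;> omega
  | const b =>
    intro a ha c hc l hl
    simp [gates, gatesAux] at hc; subst hc; simp at hl; subst hl; simp [PropForm.size]
  | neg φ ih =>
    intro a ha c hc l hl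
    simp only [propFormVarBound] at ha
    simp only [gates, gatesAux, gatesAux_snd, List.mem_append, List.mem_cons, List.not_mem_nil, or_false] at hc
    have hs := PropForm.size_pos φ
    rcases hc with hc | rfl | rfl
    · have := ih a ha c hc l hl
      simp only [PropForm.size]; omega
    all_goals simp at hl; rcases hl with rfl | rfl <;> simp only [PropForm.size] <;> omega
  | conj φ ψ ih₁ ih₂ =>
    intro a ha c hc l hl
    simp only [propFormVarBound, max_le_iff] at ha
    simp only [gates, gatesAux, gatesAux_snd, List.mem_append, List.mem_cons, List.not_mem_nil, or_false] at hc
    have hs₁ := PropForm.size_pos φ; have hs₂ := PropForm.size_pos ψ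
    rcases hc with (hc | hc) | rfl | rfl | rfl
    · have := ih₁ a ha.1 c hc l hl
      simp only [PropForm.size]; omega
    · have := ih₂ (a + φ.size) (ha.2.trans (by omega)) c hc l hl
      simp only [PropForm.size]; omega
    all_goals simp at hl; rcases hl with rfl | rfl | rfl <;> simp only [PropForm.size] <;> omega
  | disj φ ψ ih₁ ih₂ =>
    intro a ha c hc l hl
    simp only [propFormVarBound, max_le_iff] at ha
    simp only [gates, gatesAux, gatesAux_snd, List.mem_append, List.mem_cons, List.not_mem_nil, or_false] at hc
    have hs₁ := PropForm.size_pos φ; have hs₂ := PropForm.size_pos ψ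
    rcases hc with (hc | hc) | rfl | rfl | rfl
    · have := ih₁ a ha.1 c hc l hl
      simp only [PropForm.size]; omega
    · have := ih₂ (a + φ.size) (ha.2.trans (by omega)) c hc l hl
      simp only [PropForm.size]; omega
    all_goals simp at hl; rcases hl with rfl | rfl | rfl <;> simp only [PropForm.size] <;> omega

/-! ### Semantics: the intended auxiliary values satisfy the gates; the gates force the root -/

/-- **The intended values of the auxiliary variables**: `gateVal φ a σ v` is the value of the
subformula whose auxiliary variable is `v` (for `v` in the allocated range; `σ v` otherwise).
[cite: AroraBarakCC2009, Lemma 6.11 (proof)] -/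
def gateVal : PropForm ℕ → ℕ → (ℕ → Bool) → ℕ → Bool
  | .var x, a, σ => Function.update σ a (σ x)
  | .const b, a, σ => Function.update σ a b
  | .neg φ, a, σ => Function.update (gateVal φ a σ) (a + φ.size) (!(PropForm.eval σ φ))
  | .conj φ ψ, a, σ =>
    Function.update (gateVal ψ (a + φ.size) (gateVal φ a σ)) (a + φ.size + ψ.size)
      (PropForm.eval σ φ && PropForm.eval σ ψ)
  | .disj φ ψ, a, σ =>
    Function.update (gateVal ψ (a + φ.size) (gateVal φ a σ)) (a + φ.size + ψ.size)
      (PropForm.eval σ φ || PropForm.eval σ ψ)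

/-- The intended values do not touch variables below `a`. [folklore] -/
theorem gateVal_of_lt (φ : PropForm ℕ) : ∀ (a : ℕ) (σ : ℕ → Bool) {v : ℕ}, v < a → gateVal φ a σ v = σ v := by
  induction φ with
  | var x => intro a σ v hv; simp [gateVal, Function.update_of_ne (Nat.ne_of_lt hv)]
  | const b => intro a σ v hv; simp [gateVal, Function.update_of_ne (Nat.ne_of_lt hv)]
  | neg φ ih => intro a σ v hv; rw [gateVal, Function.update_of_ne (by omega), ih a σ hv]
  | conj φ ψ ih₁ ih₂ =>
    intro a σ v hv
    rw [gateVal, Function.update_of_ne (by omega), ih₂ _ _ (by omega), ih₁ a σ hv]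
  | disj φ ψ ih₁ ih₂ =>
    intro a σ v hv
    rw [gateVal, Function.update_of_ne (by omega), ih₂ _ _ (by omega), ih₁ a σ hv]

/-- The intended values do not touch variables at or above `a + size φ`. [folklore] -/
theorem gateVal_of_ge (φ : PropForm ℕ) : ∀ (a : ℕ) (σ : ℕ → Bool) {v : ℕ}, a + φ.size ≤ v → gateVal φ a σ v = σ v := by
  induction φ with
  | var x => intro a σ v hv; simp [PropForm.size] at hv; simp [gateVal, Function.update_of_ne (show v ≠ a by omega)]
  | const b => intro a σ v hv; simp [PropForm.size] at hv; simp [gateVal, Function.update_of_ne (show v ≠ a by omega)]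
  | neg φ ih =>
    intro a σ v hv; simp only [PropForm.size] at hv
    rw [gateVal, Function.update_of_ne (by omega), ih a σ (by omega)]
  | conj φ ψ ih₁ ih₂ =>
    intro a σ v hv; simp only [PropForm.size] at hv
    rw [gateVal, Function.update_of_ne (by omega), ih₂ _ _ (by omega), ih₁ a σ (by omega)]
  | disj φ ψ ih₁ ih₂ =>
    intro a σ v hv; simp only [PropForm.size] at hv
    rw [gateVal, Function.update_of_ne (by omega), ih₂ _ _ (by omega), ih₁ a σ (by omega)]

/-- The intended value of the root is the value of the formula. [cite: AroraBarakCC2009, Lemma 6.11 (proof)] -/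
theorem gateVal_root (φ : PropForm ℕ) (a : ℕ) (σ : ℕ → Bool) (ha : propFormVarBound φ ≤ a) :
    gateVal φ a σ (root φ a) = φ.eval σ := by
  cases φ with
  | var x => simp [gateVal, root, PropForm.size, PropForm.eval]
  | const b => simp [gateVal, root, PropForm.size, PropForm.eval]
  | neg φ => simp [gateVal, root, PropForm.size, PropForm.eval, show a + (φ.size + 1) - 1 = a + φ.size by omega]
  | conj φ ψ =>
    simp [gateVal, root, PropForm.size, PropForm.eval, show a + (φ.size + ψ.size + 1) - 1 = a + φ.size + ψ.size by omega]
  | disj φ ψ =>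
    simp [gateVal, root, PropForm.size, PropForm.eval, show a + (φ.size + ψ.size + 1) - 1 = a + φ.size + ψ.size by omega]

/-- Evaluating a formula with variables `< a` does not see the auxiliary values. [folklore] -/
theorem eval_gateVal_eq (φ ψ : PropForm ℕ) (a : ℕ) (σ : ℕ → Bool) (hψ : propFormVarBound ψ ≤ a) :
    ψ.eval (gateVal φ a σ) = ψ.eval σ :=
  propForm_eval_congr fun _ hx => gateVal_of_lt φ a σ (lt_of_lt_of_le hx hψ)

/-- Clauses agree under assignments agreeing on their variables. [folklore] -/
theorem clause_eval_congr {σ τ : ℕ → Bool} {c : Clause ℕ} (h : ∀ l ∈ c, σ l.1 = τ l.1) :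
    Clause.eval σ c = Clause.eval τ c := by
  induction c with
  | nil => rfl
  | cons l c ih =>
    simp only [Clause.eval, List.any_cons] at ih ⊢
    rw [ih (fun l' hl' => h l' (List.mem_cons_of_mem _ hl')), Literal.eval, Literal.eval, h l (List.mem_cons_self ..)]

/-- CNFs agree under assignments agreeing on their variables. [folklore] -/
theorem cnf_eval_congr {σ τ : ℕ → Bool} {C : CNF ℕ} (h : ∀ c ∈ C, ∀ l ∈ c, σ l.1 = τ l.1) :
    C.eval σ = C.eval τ := by
  induction C with
  | nil => rfl
  | cons c C ih =>
    rw [CNF.eval_cons, CNF.eval_cons, clause_eval_congr (h c (List.mem_cons_self ..)),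
      ih (fun c' hc' => h c' (List.mem_cons_of_mem _ hc'))]

/-- The gate clauses of `φ` (allocated from `a`, matrix variables `< a`) do not see an assignment
change at or above `a + size φ`, nor a change that preserves everything below `a + size φ`. [folklore] -/
theorem eval_gates_congr (φ : PropForm ℕ) (a : ℕ) (hφ : propFormVarBound φ ≤ a) {σ τ : ℕ → Bool}
    (h : ∀ v < a + φ.size, σ v = τ v) : (gates φ a).eval σ = (gates φ a).eval τ :=
  cnf_eval_congr fun c hc l hl => h _ (gates_vars_lt φ a hφ c hc l hl)

/-- A two-literal clause, evaluated. [folklore] -/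
theorem clause_eval_two (σ : ℕ → Bool) (u v : ℕ) (b c : Bool) :
    Clause.eval σ [(u, b), (v, c)] = (σ u == b || σ v == c) := by
  simp [Clause.eval, Literal.eval]

/-- A three-literal clause, evaluated. [folklore] -/
theorem clause_eval_three (σ : ℕ → Bool) (u v w : ℕ) (b c d : Bool) :
    Clause.eval σ [(u, b), (v, c), (w, d)] = (σ u == b || (σ v == c || σ w == d)) := by
  simp [Clause.eval, Literal.eval]

/-- **The intended values satisfy the gate clauses.** [cite: AroraBarakCC2009, Lemma 6.11 (proof)] -/
theorem eval_gates_gateVal (φ : PropForm ℕ) : ∀ (a : ℕ) (σ : ℕ → Bool), propFormVarBound φ ≤ a →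
    (gates φ a).eval (gateVal φ a σ) = true := by
  induction φ with
  | var x =>
    intro a σ ha
    simp only [propFormVarBound] at ha
    have hxa : x ≠ a := by omega
    rw [gates, gatesAux]
    simp only [CNF.eval_cons, clause_eval_two, gateVal, Function.update_self, Function.update_of_ne hxa]
    cases σ x <;> simp [CNF.eval]
  | const b =>
    intro a σ ha
    rw [gates, gatesAux]
    cases b <;> simp [CNF.eval, Literal.eval, gateVal]
  | neg φ ih =>
    intro a σ ha
    simp only [propFormVarBound] at ha
    have hs := PropForm.size_pos φ
    have hroot := gateVal_root φ a σ ha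
    rw [root] at hroot
    rw [gates, gatesAux]
    simp only [gatesAux_snd]
    rw [show (gatesAux φ a).1 = gates φ a from rfl, CNF.eval, List.all_append, Bool.and_eq_true]
    refine ⟨?_, ?_⟩
    · have hc : (gates φ a).eval (Function.update (gateVal φ a σ) (a + φ.size) (!φ.eval σ)) = (gates φ a).eval (gateVal φ a σ) :=
        eval_gates_congr φ a ha fun v hv => Function.update_of_ne (by omega) _ _
      rw [← CNF.eval, gateVal, hc]; exact ih a σ ha
    · rw [gateVal]
      have e1 : Function.update (gateVal φ a σ) (a + φ.size) (!PropForm.eval σ φ) (a + φ.size) = !PropForm.eval σ φ :=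
        Function.update_self ..
      have e2 : Function.update (gateVal φ a σ) (a + φ.size) (!PropForm.eval σ φ) (a + φ.size - 1) = PropForm.eval σ φ := by
        rw [Function.update_of_ne (by omega), hroot]
      simp only [List.all_cons, List.all_nil, Bool.and_true, Bool.and_eq_true, List.any_cons, List.any_nil,
        Bool.or_false, Literal.eval, e1, e2]
      cases PropForm.eval σ φ <;> simp
  | conj φ ψ ih₁ ih₂ =>
    intro a σ ha
    simp only [propFormVarBound, max_le_iff] at ha
    have hs₁ := PropForm.size_pos φ; have hs₂ := PropForm.size_pos ψ
    have hψ : propFormVarBound ψ ≤ a + φ.size := ha.2.trans (Nat.le_add_right _ _)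
    have hr₁ : gateVal φ a σ (a + φ.size - 1) = φ.eval σ := gateVal_root φ a σ ha.1
    have hr₂ : gateVal ψ (a + φ.size) (gateVal φ a σ) (a + φ.size + ψ.size - 1) = ψ.eval σ := by
      rw [show a + φ.size + ψ.size - 1 = root ψ (a + φ.size) by rw [root], gateVal_root ψ _ _ hψ,
        eval_gateVal_eq φ ψ a σ ha.2]
    rw [gates, gatesAux]
    simp only [gatesAux_snd]
    rw [show (gatesAux φ a).1 = gates φ a from rfl, show (gatesAux ψ (a + φ.size)).1 = gates ψ (a + φ.size) from rfl,
      CNF.eval, List.all_append, List.all_append, Bool.and_eq_true, Bool.and_eq_true, gateVal]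
    refine ⟨⟨?_, ?_⟩, ?_⟩
    · have hc : (gates φ a).eval (Function.update (gateVal ψ (a + φ.size) (gateVal φ a σ)) (a + φ.size + ψ.size)
          (φ.eval σ && ψ.eval σ)) = (gates φ a).eval (gateVal φ a σ) :=
        eval_gates_congr φ a ha.1 fun v hv => by rw [Function.update_of_ne (by omega), gateVal_of_lt ψ _ _ hv]
      rw [← CNF.eval, hc]; exact ih₁ a σ ha.1
    · have hc : (gates ψ (a + φ.size)).eval (Function.update (gateVal ψ (a + φ.size) (gateVal φ a σ)) (a + φ.size + ψ.size)
          (φ.eval σ && ψ.eval σ)) = (gates ψ (a + φ.size)).eval (gateVal ψ (a + φ.size) (gateVal φ a σ)) :=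
        eval_gates_congr ψ (a + φ.size) hψ fun v hv => Function.update_of_ne (by omega) _ _
      rw [← CNF.eval, hc]; exact ih₂ _ _ hψ
    · have e0 : Function.update (gateVal ψ (a + φ.size) (gateVal φ a σ)) (a + φ.size + ψ.size) (φ.eval σ && ψ.eval σ)
          (a + φ.size + ψ.size) = (φ.eval σ && ψ.eval σ) := Function.update_self ..
      have e1 : Function.update (gateVal ψ (a + φ.size) (gateVal φ a σ)) (a + φ.size + ψ.size) (φ.eval σ && ψ.eval σ)
          (a + φ.size - 1) = φ.eval σ := by
        rw [Function.update_of_ne (by omega), gateVal_of_lt ψ (a + φ.size) _ (show a + φ.size - 1 < a + φ.size by omega), hr₁]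
      have e2 : Function.update (gateVal ψ (a + φ.size) (gateVal φ a σ)) (a + φ.size + ψ.size) (φ.eval σ && ψ.eval σ)
          (a + φ.size + ψ.size - 1) = ψ.eval σ := by
        rw [Function.update_of_ne (by omega), hr₂]
      simp only [List.all_cons, List.all_nil, Bool.and_true, Bool.and_eq_true, List.any_cons, List.any_nil,
        Bool.or_false, Literal.eval, e0, e1, e2]
      cases PropForm.eval σ φ <;> cases PropForm.eval σ ψ <;> simp
  | disj φ ψ ih₁ ih₂ =>
    intro a σ ha
    simp only [propFormVarBound, max_le_iff] at ha
    have hs₁ := PropForm.size_pos φ; have hs₂ := PropForm.size_pos ψ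
    have hψ : propFormVarBound ψ ≤ a + φ.size := ha.2.trans (Nat.le_add_right _ _)
    have hr₁ : gateVal φ a σ (a + φ.size - 1) = φ.eval σ := gateVal_root φ a σ ha.1
    have hr₂ : gateVal ψ (a + φ.size) (gateVal φ a σ) (a + φ.size + ψ.size - 1) = ψ.eval σ := by
      rw [show a + φ.size + ψ.size - 1 = root ψ (a + φ.size) by rw [root], gateVal_root ψ _ _ hψ,
        eval_gateVal_eq φ ψ a σ ha.2]
    rw [gates, gatesAux]
    simp only [gatesAux_snd]
    rw [show (gatesAux φ a).1 = gates φ a from rfl, show (gatesAux ψ (a + φ.size)).1 = gates ψ (a + φ.size) from rfl,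
      CNF.eval, List.all_append, List.all_append, Bool.and_eq_true, Bool.and_eq_true, gateVal]
    refine ⟨⟨?_, ?_⟩, ?_⟩
    · have hc : (gates φ a).eval (Function.update (gateVal ψ (a + φ.size) (gateVal φ a σ)) (a + φ.size + ψ.size)
          (φ.eval σ || ψ.eval σ)) = (gates φ a).eval (gateVal φ a σ) :=
        eval_gates_congr φ a ha.1 fun v hv => by rw [Function.update_of_ne (by omega), gateVal_of_lt ψ _ _ hv]
      rw [← CNF.eval, hc]; exact ih₁ a σ ha.1
    · have hc : (gates ψ (a + φ.size)).eval (Function.update (gateVal ψ (a + φ.size) (gateVal φ a σ)) (a + φ.size + ψ.size)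
          (φ.eval σ || ψ.eval σ)) = (gates ψ (a + φ.size)).eval (gateVal ψ (a + φ.size) (gateVal φ a σ)) :=
        eval_gates_congr ψ (a + φ.size) hψ fun v hv => Function.update_of_ne (by omega) _ _
      rw [← CNF.eval, hc]; exact ih₂ _ _ hψ
    · have e0 : Function.update (gateVal ψ (a + φ.size) (gateVal φ a σ)) (a + φ.size + ψ.size) (φ.eval σ || ψ.eval σ)
          (a + φ.size + ψ.size) = (φ.eval σ || ψ.eval σ) := Function.update_self ..
      have e1 : Function.update (gateVal ψ (a + φ.size) (gateVal φ a σ)) (a + φ.size + ψ.size) (φ.eval σ || ψ.eval σ)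
          (a + φ.size - 1) = φ.eval σ := by
        rw [Function.update_of_ne (by omega), gateVal_of_lt ψ (a + φ.size) _ (show a + φ.size - 1 < a + φ.size by omega), hr₁]
      have e2 : Function.update (gateVal ψ (a + φ.size) (gateVal φ a σ)) (a + φ.size + ψ.size) (φ.eval σ || ψ.eval σ)
          (a + φ.size + ψ.size - 1) = ψ.eval σ := by
        rw [Function.update_of_ne (by omega), hr₂]
      simp only [List.all_cons, List.all_nil, Bool.and_true, Bool.and_eq_true, List.any_cons, List.any_nil,
        Bool.or_false, Literal.eval, e0, e1, e2]
      cases PropForm.eval σ φ <;> cases PropForm.eval σ ψ <;> simp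

/-- **The gate clauses force the root**: any assignment satisfying the gate clauses of `φ` (matrix
variables `< a`) gives the root auxiliary variable the value of `φ`. [cite: AroraBarakCC2009, Lemma 6.11 (proof)] -/
theorem root_eq_of_eval_gates (φ : PropForm ℕ) : ∀ (a : ℕ) (τ : ℕ → Bool), propFormVarBound φ ≤ a →
    (gates φ a).eval τ = true → τ (root φ a) = φ.eval τ := by
  induction φ with
  | var x =>
    intro a τ ha h
    rw [gates, gatesAux] at h
    simp only [CNF.eval_cons, List.any_cons, List.any_nil, Bool.or_false, Literal.eval, Bool.and_eq_true,
      Bool.or_eq_true, beq_iff_eq, Clause.eval] at h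
    simp only [root, PropForm.size, Nat.add_sub_cancel, PropForm.eval]
    obtain ⟨h1, h2, -⟩ := h
    cases hx : τ x <;> cases ha' : τ a <;> simp_all
  | const b =>
    intro a τ ha h
    rw [gates, gatesAux] at h
    simp only [CNF.eval_cons, Bool.and_eq_true] at h
    simp only [root, PropForm.size, Nat.add_sub_cancel, PropForm.eval]
    simpa [Clause.eval, Literal.eval] using h.1
  | neg φ ih =>
    intro a τ ha h
    simp only [propFormVarBound] at ha
    have hs := PropForm.size_pos φ
    rw [gates, gatesAux] at h
    simp only [gatesAux_snd] at h
    rw [show (gatesAux φ a).1 = gates φ a from rfl, CNF.eval, List.all_append, Bool.and_eq_true] at h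
    obtain ⟨h₁, h₂⟩ := h
    have hr := ih a τ ha (by rwa [CNF.eval])
    rw [root] at hr
    simp only [List.all_cons, List.all_nil, Bool.and_true, List.any_cons, List.any_nil, Bool.or_false,
      Literal.eval, Bool.and_eq_true, Bool.or_eq_true, beq_iff_eq, hr] at h₂
    rw [root, PropForm.size, show a + (φ.size + 1) - 1 = a + φ.size by omega, PropForm.eval]
    obtain ⟨h1, h2⟩ := h₂
    cases hg : τ (a + φ.size) <;> cases hv : PropForm.eval τ φ <;> simp_all
  | conj φ ψ ih₁ ih₂ =>
    intro a τ ha h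
    simp only [propFormVarBound, max_le_iff] at ha
    have hs₁ := PropForm.size_pos φ; have hs₂ := PropForm.size_pos ψ
    have hψ : propFormVarBound ψ ≤ a + φ.size := ha.2.trans (Nat.le_add_right _ _)
    rw [gates, gatesAux] at h
    simp only [gatesAux_snd] at h
    rw [show (gatesAux φ a).1 = gates φ a from rfl, show (gatesAux ψ (a + φ.size)).1 = gates ψ (a + φ.size) from rfl,
      CNF.eval, List.all_append, List.all_append, Bool.and_eq_true, Bool.and_eq_true] at h
    obtain ⟨⟨h₁, h₂⟩, h₃⟩ := h
    have hr₁ := ih₁ a τ ha.1 (by rwa [CNF.eval])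
    have hr₂ := ih₂ _ τ hψ (by rwa [CNF.eval])
    rw [root] at hr₁ hr₂
    simp only [List.all_cons, List.all_nil, Bool.and_true, List.any_cons, List.any_nil, Bool.or_false,
      Literal.eval, Bool.and_eq_true, Bool.or_eq_true, beq_iff_eq, hr₁, hr₂] at h₃
    rw [root, PropForm.size, show a + (φ.size + ψ.size + 1) - 1 = a + φ.size + ψ.size by omega, PropForm.eval]
    obtain ⟨h31, h32, h33⟩ := h₃
    cases hg : τ (a + φ.size + ψ.size) <;> cases hφv : PropForm.eval τ φ <;> cases hψv : PropForm.eval τ ψ <;> simp_all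
  | disj φ ψ ih₁ ih₂ =>
    intro a τ ha h
    simp only [propFormVarBound, max_le_iff] at ha
    have hs₁ := PropForm.size_pos φ; have hs₂ := PropForm.size_pos ψ
    have hψ : propFormVarBound ψ ≤ a + φ.size := ha.2.trans (Nat.le_add_right _ _)
    rw [gates, gatesAux] at h
    simp only [gatesAux_snd] at h
    rw [show (gatesAux φ a).1 = gates φ a from rfl, show (gatesAux ψ (a + φ.size)).1 = gates ψ (a + φ.size) from rfl,
      CNF.eval, List.all_append, List.all_append, Bool.and_eq_true, Bool.and_eq_true] at h
    obtain ⟨⟨h₁, h₂⟩, h₃⟩ := h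
    have hr₁ := ih₁ a τ ha.1 (by rwa [CNF.eval])
    have hr₂ := ih₂ _ τ hψ (by rwa [CNF.eval])
    rw [root] at hr₁ hr₂
    simp only [List.all_cons, List.all_nil, Bool.and_true, List.any_cons, List.any_nil, Bool.or_false,
      Literal.eval, Bool.and_eq_true, Bool.or_eq_true, beq_iff_eq, hr₁, hr₂] at h₃
    rw [root, PropForm.size, show a + (φ.size + ψ.size + 1) - 1 = a + φ.size + ψ.size by omega, PropForm.eval]
    obtain ⟨h31, h32, h33⟩ := h₃
    cases hg : τ (a + φ.size + ψ.size) <;> cases hφv : PropForm.eval τ φ <;> cases hψv : PropForm.eval τ ψ <;> simp_all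

/-! ### The transformation preserves truth -/

/-- **The Tseitin CNF of a matrix**: the gate clauses and the unit clause asserting the root.
[cite: AroraBarakCC2009, Lemma 6.11 (proof)] -/
def cnf (φ : PropForm ℕ) (a : ℕ) : CNF ℕ := gates φ a ++ [[(root φ a, true)]]

/-- Writing the auxiliary block read off an assignment that agrees with `σ` outside it gives that
assignment back. [folklore] -/
theorem writeVec_readVec_eq {σ g : ℕ → Bool} {a n : ℕ} (hlt : ∀ v < a, g v = σ v) (hge : ∀ v, a + n ≤ v → g v = σ v) :
    writeVec σ a (readVec g a n) = g := by
  funext v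
  rcases lt_or_ge v a with hv | hv
  · rw [writeVec_of_lt σ a _ hv, hlt v hv]
  · rcases lt_or_ge v (a + n) with hv' | hv'
    · obtain ⟨j, rfl⟩ : ∃ j, v = a + j := ⟨v - a, by omega⟩
      have hj : j < (readVec g a n).length := by simp [readVec]; omega
      rw [writeVec_add σ a _ hj, getElem_readVec]
    · rw [writeVec_of_ge σ a _ (by simpa [readVec] using hv'), hge v hv']

/-- **Tseitin's equivalence**: for a matrix with variables `< a`, `φ` is true under `σ` iff some values
of the auxiliary block `a, …, a + size φ − 1` make the Tseitin CNF true.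
[cite: AroraBarakCC2009, Lemma 6.11 (proof)] -/
theorem eval_iff_exists (φ : PropForm ℕ) (a : ℕ) (ha : propFormVarBound φ ≤ a) (σ : ℕ → Bool) :
    φ.eval σ = true ↔ ∃ w : List Bool, w.length = φ.size ∧ (cnf φ a).eval (writeVec σ a w) = true := by
  constructor
  · intro h
    refine ⟨readVec (gateVal φ a σ) a φ.size, by simp [readVec], ?_⟩
    rw [writeVec_readVec_eq (fun v hv => gateVal_of_lt φ a σ hv) (fun v hv => gateVal_of_ge φ a σ hv), cnf,
      CNF.eval, List.all_append, Bool.and_eq_true]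
    refine ⟨by rw [← CNF.eval]; exact eval_gates_gateVal φ a σ ha, ?_⟩
    simp [Literal.eval, gateVal_root φ a σ ha, h]
  · rintro ⟨w, hw, h⟩
    rw [cnf, CNF.eval, List.all_append, Bool.and_eq_true] at h
    obtain ⟨h₁, h₂⟩ := h
    have hr := root_eq_of_eval_gates φ a (writeVec σ a w) ha (by rwa [CNF.eval])
    simp only [List.all_cons, List.all_nil, Bool.and_true, List.any_cons, List.any_nil, Bool.or_false,
      Literal.eval, beq_iff_eq] at h₂
    rw [h₂] at hr
    rw [← propForm_eval_congr (φ := φ) (σ := σ) (τ := writeVec σ a w)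
      (fun x hx => (writeVec_of_lt σ a w (lt_of_lt_of_le hx ha)).symm)] at hr
    exact hr.symm

/-- Changing the matrix to one that, after extra quantifiers at the end of the prefix, computes the
same thing. [folklore] -/
theorem qbfEval_congr_matrix (φ₁ φ₂ : PropForm ℕ) (extra : List Bool) (T : ℕ)
    (h : ∀ σ : ℕ → Bool, φ₁.eval σ = true ↔ qbfEval φ₂ extra T σ = true) :
    ∀ (qs : List Bool) (i : ℕ) (σ : ℕ → Bool), i + qs.length = T →
      (qbfEval φ₁ qs i σ = true ↔ qbfEval φ₂ (qs ++ extra) i σ = true)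
  | [], i, σ, hi => by rw [List.nil_append, qbfEval]; rw [List.length_nil, Nat.add_zero] at hi; subst hi; exact h σ
  | q :: qs, i, σ, hi => by
    rw [List.cons_append, qbfEval, qbfEval]
    have hi' : i + 1 + qs.length = T := by rw [List.length_cons] at hi; omega
    have h0 := qbfEval_congr_matrix φ₁ φ₂ extra T h qs (i + 1) (Function.update σ i false) hi'
    have h1 := qbfEval_congr_matrix φ₁ φ₂ extra T h qs (i + 1) (Function.update σ i true) hi'
    cases q <;> simp only [cond_true, cond_false, Bool.and_eq_true, Bool.or_eq_true, h0, h1]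

/-- **The Tseitin form of a prenex QBF**: the auxiliary variables of the matrix, allocated from
`|qs|`, are quantified existentially innermost; the matrix becomes the Tseitin 3-CNF.
[cite: TrevisanVadhan2007, §4 (proof of Lemma 4.1: "we may assume … `ψ` is a CNF formula")] -/
def tseitinQBF (ψ : PrenexQBF) : PrenexQBF :=
  ⟨ψ.quants ++ List.replicate ψ.matrix.size false, PropForm.ofCNF (cnf ψ.matrix ψ.quants.length)⟩

/-- Variable bound of the formula of a CNF. [folklore] -/
theorem propFormVarBound_ofCNF_le {C : CNF ℕ} {B : ℕ} (h : ∀ c ∈ C, ∀ l ∈ c, l.1 < B) :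
    propFormVarBound (PropForm.ofCNF C) ≤ B := by
  induction C with
  | nil => simp [PropForm.ofCNF, propFormVarBound]
  | cons c C ih =>
    rw [PropForm.ofCNF, List.foldr_cons]
    rw [PropForm.ofCNF] at ih
    simp only [propFormVarBound, max_le_iff]
    refine ⟨?_, ih fun c' hc' => h c' (List.mem_cons_of_mem _ hc')⟩
    have hc := h c (List.mem_cons_self ..)
    clear h ih
    induction c with
    | nil => simp [propFormVarBound]
    | cons l c ihc =>
      rw [List.foldr_cons]
      simp only [propFormVarBound, max_le_iff]
      refine ⟨?_, ihc fun l' hl' => hc l' (List.mem_cons_of_mem _ hl')⟩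
      have := hc l (List.mem_cons_self ..)
      split <;> simp [propFormVarBound] <;> omega

/-- **The Tseitin form of a closed prenex QBF is closed.** [folklore] -/
theorem isClosed_tseitinQBF {ψ : PrenexQBF} (h : ψ.IsClosed) : (tseitinQBF ψ).IsClosed := by
  rw [PrenexQBF.IsClosed, tseitinQBF]
  simp only [List.length_append, List.length_replicate]
  refine propFormVarBound_ofCNF_le fun c hc l hl => ?_
  rw [cnf, List.mem_append] at hc
  rcases hc with hc | hc
  · exact gates_vars_lt ψ.matrix _ h c hc l hl
  · simp at hc; subst hc; simp at hl; subst hl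
    rw [root]; have := PropForm.size_pos ψ.matrix; omega

/-- **Tseitin preserves the truth of a closed prenex QBF** (the `∃`-block of auxiliary values exists
iff the matrix is true, at every assignment of the original variables). [cite: TrevisanVadhan2007, §4 (proof of Lemma 4.1)] -/
theorem isTrue_tseitinQBF_iff {ψ : PrenexQBF} (h : ψ.IsClosed) : (tseitinQBF ψ).IsTrue ↔ ψ.IsTrue := by
  rw [PrenexQBF.IsTrue, PrenexQBF.IsTrue, tseitinQBF]
  symm
  refine qbfEval_congr_matrix ψ.matrix _ _ ψ.quants.length (fun σ => ?_) ψ.quants 0 (fun _ => false) (by simp)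
  -- at the end of the original prefix: the `∃`-block over the auxiliaries
  rw [show List.replicate ψ.matrix.size false = List.replicate ψ.matrix.size false ++ [] by rw [List.append_nil],
    qbfEval_replicate_false_append, eval_iff_exists ψ.matrix ψ.quants.length h σ]
  simp only [qbfEval, PropForm.eval_ofCNF]

end Tseitin

end Literature.Computability.Complexity
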